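import Literature.MathematicalPhysics.QuantumFieldTheory.Balaban1983to89.T4ApexVariance
import Summits.QuantumFields.BalabanUV.T4Continuum.Support.NE7ApexFrozenPeierls
import HarnessLib

/-!
# NE7ApexFrozenScheme — nodes U0 (`Missing.HasContinuumLimit`) and U5 (`T4ApexVariance.StringwiseMatching`) for ANY torus scheme over a
# finite gauge group with a trace gap whose observables freeze on the flat sector, from a summable majorant of the frozen rate (theorems only)

HONEST FRAMING (page 1).  Cell `pub-balaban`, rung (B)+1 sub-cell t4, lineage `b2b-balaban-t4-ne7-p1`, generation 31 (CRUX PROVER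
NE7 #1, ruling e34b3e0c (2)); skeleton `t4/skeletons/NE7-CRUX-R1.md` v1.7.10.  FIXED FINITE T⁴; continuum `SU(N)` Yang–Mills on T⁴ ⇐
BetaPertH ∧ nine spine estimates (0∕9 proved); BetaPertH ⇐ (D1) ∧ (D4) ∧ CAP+tail; G-an2-4 gates asym, D1 and NE2∕3∕4; NOT infinite
volume, NOT mass gap, NOT Clay.  The crux NE7 (node U5 = `T4ApexVariance.StringwiseMatching` for Bałaban's scheme) and the apex U0
(`Missing.HasContinuumLimit`) are NOT PRINTED and NOT PROVED, and NOTHING below bears on them: this is [our toy] — an HONEST lattice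
gauge theory (Wilson's action, product Haar measure, gauge-invariant observables of `Setup` ∕ `Missing`) in the one regime where an
elementary estimate decides everything, a FINITE gauge group at FROZEN couplings.  Its value: every inhabitant of the two apex
predicates this owner could find in the tree (gen 31 search of the `HasContinuumLimit` ∕ `StringwiseMatching` conclusions:
`T4VarianceMatching`, `T4PathMeanHybrid`, `NE7Pairwise*`, `NE7LawLevel*`, `CovariantMean*`, …) is CONDITIONAL on a rate hypothesis, and
the only unconditional statement about a concrete lattice gauge theory is compactness (`WilsonLoopLimit`: "nothing about the
dynamics of the lattice theory is used anywhere"); the four modules `NE7ApexFrozenPeierls` ∕ `NE7ApexFrozenScheme` (theorems, any finite group) and `NE7ApexFrozenDefs` ∕ `NE7ApexFrozenWitness` (the `Z2` plaquette instance)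
inhabit BOTH predicates OUTRIGHT by a Peierls-type energy–entropy bound under the Gibbs measure — a NON-VACUITY WITNESS of the apex
SHAPES by a lattice gauge theory and a calibration family for apex-level sockets.  The regime is DEGENERATE (no asymptotic freedom;
the limit theory is the trivial flat sector, every string expectation tends to `1`); NOT `SU(N)`, NOT Bałaban's renormalisation
group, NOT NE7, NOT summit progress.

THE MATHEMATICS OF THIS MODULE ([folklore]).  `G` finite with trace gap `Δ` (`NE7ApexFrozenPeierls`), `S : Missing.TorusScheme G O` with
`β_K ≥ 0`, observables bounded by `1` and EQUAL TO `1` ON ACTION-ZERO CONFIGURATIONS (plaquette variables and their products qualify, for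
every gauge group — `NE7ApexFrozenWitness`), and ANY MAJORANT `r` of the frozen rate: `|G|^{n_K}·e^{−Δβ_K} ≤ r_K` (`n_K` = bonds of the
`K`-th torus; the majorant form keeps this module free of definitions).
* `abs_expectAt_sub_one_le`: `|⟨∏_{o∈os} obs_K(o)⟩_K − 1| ≤ 2·r_K` (the Peierls bound on the product observable);
* **`hasContinuumLimit_of_majorant_tendsto_zero`: `r_K → 0 ⇒ Missing.HasContinuumLimit S`**, with the limit identified
  (`tendsto_expectAt_one`: every joint expectation tends to `1`);
* `abs_genFun_sub_le`: the cumulant generating functions `G_K = T4CauchySum.genFun (schemeZ S os) K = log⟨e^{tF_K}⟩_K` satisfy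
  `|G_K(t) − t| ≤ 8e²·r_K` on `|t| ≤ 1` (`⟨e^{tF}⟩ = e^t(1 + y)`, `|y| ≤ 2e²r_K`, `|log(1 + y)| ≤ 2|y|` when `2e²r_K ≤ 1∕2`, proved
  in place; the a-priori `|G_K(t)| ≤ |t|` of `T4GenFunBounds` otherwise);
* **`stringwiseMatching_of_summable_majorant`: `Σ r_K < ∞ ⇒ T4ApexVariance.StringwiseMatching S`** at radius `1`, volume factor `8e²`,
  remainder `δ_K = r_K + r_{K+1}` (`T4CauchySum.MatchingModConstants` with `c_K = log Z_{K+1}(0) − log Z_K(0)`);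
* `apex_of_summable_majorant`: both at once.
No definition; no socket, binder or hypothesis shape.  Consumer: `NE7ApexFrozenWitness` (the `Z2` plaquette scheme, `r_K = e^{−2K}`).
-/

set_option autoImplicit false

noncomputable section

open MeasureTheory Filter Topology ProbabilityTheory
open scoped BigOperators ENNReal

namespace Summit.QuantumFields.BalabanUV.T4Continuum.NE7ApexFrozenScheme

open Literature.MathematicalPhysics.QuantumFieldTheory.Balaban1983to89
open Missing (boltzmann partitionFn expect TorusScheme HasContinuumLimit)
open NE7ApexFrozenPeierls

/-! ## §1 Scheme level: the two apex predicates from a summable majorant of the frozen rate -/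

section Scheme

variable {G : Type*} [GaugeGroup G] [Fintype G] [MeasurableSpace G] [MeasurableSingletonClass G] [HaarData G]
  [RegularGaugeGroup G] {O : Type*}

variable (S : TorusScheme G O) {Δ : ℝ} {r : ℕ → ℝ} (hβ : ∀ K, 0 ≤ S.β K)
  (hgap : ∀ g : G, reTr g < 1 → Δ ≤ 1 - reTr g)
  (h1 : ∀ K o U, |S.obs K o U| ≤ 1) (hflat : ∀ K o U, wilsonAction4 U = 0 → S.obs K o U = 1)
  (hr : ∀ K, (Fintype.card G : ℝ) ^ Fintype.card (PBond (S.P K) 0) * Real.exp (-(Δ * S.β K)) ≤ r K)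
include hβ hgap h1 hflat hr

omit [Fintype G] [MeasurableSpace G] [MeasurableSingletonClass G] [HaarData G] [RegularGaugeGroup G] hβ hgap hr in
/-- The product observable of a string is bounded by `1` and equals `1` on the flat sector. [folklore] -/
theorem prodObs_bounds (K : ℕ) (os : List O) :
    (∀ U, |T4GenFunBounds.prodObs S K os U| ≤ 1) ∧
      ∀ U : GaugeField (S.P K) 0 G, wilsonAction4 U = 0 → T4GenFunBounds.prodObs S K os U = 1 := by
  refine ⟨T4GenFunBounds.abs_prodObs_le_one S h1 K os, fun U hU => ?_⟩
  simp only [T4GenFunBounds.prodObs]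
  exact List.prod_eq_one fun x hx => by
    obtain ⟨o, -, rfl⟩ := List.mem_map.mp hx
    exact hflat K o U hU

omit [MeasurableSpace G] [MeasurableSingletonClass G] [HaarData G] [RegularGaugeGroup G] hβ hgap h1 hflat in
/-- A majorant of the frozen rate is nonnegative. [folklore] -/
theorem majorant_nonneg (K : ℕ) : 0 ≤ r K :=
  (by positivity : (0 : ℝ) ≤ (Fintype.card G : ℝ) ^ Fintype.card (PBond (S.P K) 0) * Real.exp (-(Δ * S.β K))).trans (hr K)

/-- **STRING EXPECTATIONS FREEZE**: `|⟨∏_{o∈os} obs_K(o)⟩_K − 1| ≤ 2·r_K` for every string and every `K`, `r` any majorant of the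
frozen rate `|G|^{n_K}e^{−Δβ_K}`. [folklore] -/
theorem abs_expectAt_sub_one_le (K : ℕ) (os : List O) : |S.expectAt K os - 1| ≤ 2 * r K := by
  obtain ⟨hb, hf⟩ := prodObs_bounds S h1 hflat K os
  have h := abs_expect_sub_one_le (hβ K) hgap (S.P K) hb hf
  change |expect (G := G) (S.P K) (S.β K) (T4GenFunBounds.prodObs S K os) - 1| ≤ _
  calc |expect (G := G) (S.P K) (S.β K) (T4GenFunBounds.prodObs S K os) - 1|
      ≤ 2 * ((Fintype.card G : ℝ) ^ Fintype.card (PBond (S.P K) 0) * Real.exp (-(Δ * S.β K))) :=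
        h.trans_eq (by ring)
    _ ≤ 2 * r K := by gcongr; exact hr K

/-- **NODE U0 — `Missing.HasContinuumLimit S`** for a scheme over a finite group with trace gap whose observables are bounded by `1`
and equal `1` on the flat sector, as soon as some majorant of the frozen rate tends to `0`: every joint expectation converges (to
`1`). [folklore] -/
theorem hasContinuumLimit_of_majorant_tendsto_zero (hr0 : Tendsto r atTop (𝓝 0)) : HasContinuumLimit S := by
  intro os
  refine ⟨1, ?_⟩
  have h0 : Tendsto (fun K => S.expectAt K os - 1) atTop (𝓝 0) :=
    squeeze_zero_norm (a := fun K => 2 * r K)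
      (fun K => by rw [Real.norm_eq_abs]; exact abs_expectAt_sub_one_le S hβ hgap h1 hflat hr K os)
      (by simpa using hr0.const_mul 2)
  simpa using h0.add_const 1

/-- The limit identified: every joint expectation tends to `1`. [folklore] -/
theorem tendsto_expectAt_one (hr0 : Tendsto r atTop (𝓝 0)) (os : List O) :
    Tendsto (fun K => S.expectAt K os) atTop (𝓝 1) := by
  have h0 : Tendsto (fun K => S.expectAt K os - 1) atTop (𝓝 0) :=
    squeeze_zero_norm (a := fun K => 2 * r K)
      (fun K => by rw [Real.norm_eq_abs]; exact abs_expectAt_sub_one_le S hβ hgap h1 hflat hr K os)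
      (by simpa using hr0.const_mul 2)
  simpa using h0.add_const 1

/-- **THE CUMULANT GENERATING FUNCTIONS FREEZE**: `|G_K(t) − t| ≤ 8e²·r_K` for `|t| ≤ 1`, where
`G_K = T4CauchySum.genFun (schemeZ S os) K` (`= log⟨e^{tF_K}⟩_K`) and `r` is any majorant of the frozen rate. [folklore] -/
theorem abs_genFun_sub_le (K : ℕ) (os : List O) {t : ℝ} (ht : |t| ≤ 1) :
    |T4CauchySum.genFun (T4GenFunBounds.schemeZ S os) K t - t| ≤ 8 * Real.exp 2 * r K := by
  have hm : ∀ K o, Measurable (S.obs K o) := fun K o => measurable_of_finiteGroup _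
  obtain ⟨hb, hf⟩ := prodObs_bounds S h1 hflat K os
  have hr0 : 0 ≤ r K := majorant_nonneg S hr K
  set E := expect (G := G) (S.P K) (S.β K) fun U => Real.exp (t * T4GenFunBounds.prodObs S K os U) with hE
  -- the generating function is `log ⟨e^{tF}⟩`
  have hgen : T4CauchySum.genFun (T4GenFunBounds.schemeZ S os) K t = Real.log E := by
    rw [T4GenFunBounds.genFun_schemeZ_eq_cgf S hβ hm h1, cgf, ← T4GenFunBounds.expect_exp_mul_eq_mgf _ (hβ K)]
  -- `⟨e^{tF}⟩ = e^t + x` with `|x| ≤ 2e·r`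
  have het : Real.exp |t| ≤ Real.exp 1 := Real.exp_le_exp.mpr ht
  have hx : |E - Real.exp t| ≤ 2 * Real.exp 1 * r K := by
    have h := abs_expect_exp_sub_le (hβ K) hgap (S.P K) hb hf t
    calc |E - Real.exp t|
        ≤ 2 * Real.exp |t| * (Fintype.card G : ℝ) ^ Fintype.card (PBond (S.P K) 0) * Real.exp (-(Δ * S.β K)) := h
      _ = 2 * Real.exp |t| * ((Fintype.card G : ℝ) ^ Fintype.card (PBond (S.P K) 0) * Real.exp (-(Δ * S.β K))) := by
          ring
      _ ≤ 2 * Real.exp 1 * r K := by gcongr; exact hr K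
  by_cases hsmall : 2 * Real.exp 2 * r K ≤ 1 / 2
  · -- small rate: `log(e^t + x) = t + log(1 + x·e^{−t})` with `|x·e^{−t}| ≤ 2e²·r ≤ 1/2`
    set y := (E - Real.exp t) * Real.exp (-t) with hy
    have hent : Real.exp (-t) ≤ Real.exp 1 := Real.exp_le_exp.mpr ((neg_le_abs t).trans ht)
    have hyb : |y| ≤ 2 * Real.exp 2 * r K := by
      rw [hy, abs_mul, abs_of_pos (Real.exp_pos _)]
      calc |E - Real.exp t| * Real.exp (-t) ≤ 2 * Real.exp 1 * r K * Real.exp 1 :=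
            mul_le_mul hx hent (Real.exp_pos _).le (by positivity)
        _ = 2 * (Real.exp 1 * Real.exp 1) * r K := by ring
        _ = 2 * Real.exp 2 * r K := by rw [← Real.exp_add]; norm_num
    have hy2 : |y| ≤ 1 / 2 := hyb.trans hsmall
    have hpos : 0 < 1 + y := by have := (abs_le.mp hy2).1; linarith
    have hprod : Real.exp t * Real.exp (-t) = 1 := by rw [← Real.exp_add, add_neg_cancel, Real.exp_zero]
    have hEeq : E = Real.exp t * (1 + y) := by
      rw [hy]; linear_combination (-(E - Real.exp t)) * hprod
    rw [hgen, hEeq, Real.log_mul (Real.exp_pos t).ne' hpos.ne', Real.log_exp, add_sub_cancel_left]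
    -- `|log(1 + y)| ≤ 2|y|` for `|y| ≤ 1/2`, from `1 − x⁻¹ ≤ log x ≤ x − 1` (the same elementary inequality is
    -- `Literature.NumberTheory.Sieve.BombieriSieve.abs_log_one_add_le`; kept local here to avoid a cross-area import)
    have hlog : |Real.log (1 + y)| ≤ 2 * |y| := by
      have hy' := abs_le.mp hy2
      have hup : Real.log (1 + y) ≤ (1 + y) - 1 := Real.log_le_sub_one_of_pos hpos
      have hlo : 1 - (1 + y)⁻¹ ≤ Real.log (1 + y) := Real.one_sub_inv_le_log_of_pos hpos
      have hinv : 1 - (1 + y)⁻¹ = y / (1 + y) := by field_simp; ring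
      rw [hinv] at hlo
      have hlo' : -(2 * |y|) ≤ y / (1 + y) := by
        rw [le_div_iff₀ hpos]
        cases le_or_gt 0 y with
        | inl h => rw [abs_of_nonneg h]; nlinarith
        | inr h => rw [abs_of_neg h]; nlinarith
      rw [abs_le]
      exact ⟨by linarith, by linarith [le_abs_self y, abs_nonneg y]⟩
    calc |Real.log (1 + y)| ≤ 2 * |y| := hlog
      _ ≤ 2 * (2 * Real.exp 2 * r K) := by gcongr
      _ ≤ 8 * Real.exp 2 * r K := by nlinarith [Real.exp_pos (2 : ℝ)]
  · -- large rate: the a-priori bound `|G_K(t)| ≤ |t| ≤ 1` suffices, since `2 < 8e²·r`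
    push Not at hsmall
    have hcrude : |T4CauchySum.genFun (T4GenFunBounds.schemeZ S os) K t| ≤ 1 :=
      (T4GenFunBounds.abs_genFun_schemeZ_le S hβ hm h1 K os t).trans ht
    calc |T4CauchySum.genFun (T4GenFunBounds.schemeZ S os) K t - t|
        ≤ |T4CauchySum.genFun (T4GenFunBounds.schemeZ S os) K t| + |t| := abs_sub _ _
      _ ≤ 1 + 1 := add_le_add hcrude ht
      _ ≤ 8 * Real.exp 2 * r K := by linarith

/-- **NODE U5 — `T4ApexVariance.StringwiseMatching S`** for a scheme over a finite group with trace gap whose observables are bounded by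
`1` and equal `1` on the flat sector, as soon as some majorant `r` of the frozen rate is summable: every string matches modulo
constants at radius `1`, volume factor `8e²`, remainder `δ_K = r_K + r_{K+1}`. [folklore] -/
theorem stringwiseMatching_of_summable_majorant (hrs : Summable r) : T4ApexVariance.StringwiseMatching S := by
  intro os
  refine ⟨1, 8 * Real.exp 2, fun K => r K + r (K + 1), one_pos, hrs.add ((summable_nat_add_iff 1).mpr hrs), fun K => ?_⟩
  refine ⟨Real.log (T4GenFunBounds.schemeZ S os (K + 1) 0) - Real.log (T4GenFunBounds.schemeZ S os K 0),
    fun t ht => ?_⟩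
  have hK := abs_genFun_sub_le S hβ hgap h1 hflat hr K os ht
  have hK1 := abs_genFun_sub_le S hβ hgap h1 hflat hr (K + 1) os ht
  simp only [T4CauchySum.genFun] at hK hK1
  -- `(log Z_{K+1} t − log Z_K t) − (log Z_{K+1} 0 − log Z_K 0) = (G_{K+1} t − t) − (G_K t − t)`
  calc |Real.log (T4GenFunBounds.schemeZ S os (K + 1) t) - Real.log (T4GenFunBounds.schemeZ S os K t) -
          (Real.log (T4GenFunBounds.schemeZ S os (K + 1) 0) - Real.log (T4GenFunBounds.schemeZ S os K 0))|
      = |(Real.log (T4GenFunBounds.schemeZ S os (K + 1) t) - Real.log (T4GenFunBounds.schemeZ S os (K + 1) 0) - t) -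
          (Real.log (T4GenFunBounds.schemeZ S os K t) - Real.log (T4GenFunBounds.schemeZ S os K 0) - t)| := by
        ring_nf
    _ ≤ |Real.log (T4GenFunBounds.schemeZ S os (K + 1) t) - Real.log (T4GenFunBounds.schemeZ S os (K + 1) 0) - t| +
          |Real.log (T4GenFunBounds.schemeZ S os K t) - Real.log (T4GenFunBounds.schemeZ S os K 0) - t| :=
        abs_sub _ _
    _ ≤ 8 * Real.exp 2 * r (K + 1) + 8 * Real.exp 2 * r K := add_le_add hK1 hK
    _ = 8 * Real.exp 2 * (r K + r (K + 1)) := by ring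

/-- **Both apex predicates at once** from a summable majorant of the frozen rate. [folklore] -/
theorem apex_of_summable_majorant (hrs : Summable r) :
    HasContinuumLimit S ∧ T4ApexVariance.StringwiseMatching S :=
  ⟨hasContinuumLimit_of_majorant_tendsto_zero S hβ hgap h1 hflat hr hrs.tendsto_atTop_zero,
    stringwiseMatching_of_summable_majorant S hβ hgap h1 hflat hr hrs⟩

end Scheme

end Summit.QuantumFields.BalabanUV.T4Continuum.NE7ApexFrozenScheme

end
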